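import Summits.RiemannHypothesis.RiemannHypothesis.Theses.WeilComb
import Literature.NumberTheory.LFunctions.UniformWeilPositivityRH
import Literature.NumberTheory.LFunctions.WeilExplicitProofs
import Literature.NumberTheory.LFunctions.WeilExplicitFormulaProofs
import Literature.NumberTheory.LFunctions.WeilGroundEnergyProofs

/-!
# Disproof of `CombSubcritical` — findings (cdisprove seat, crux `stmt-RiemannHypothesis-1025`)

Crux (route `WeilComb`, "Theorem A"):
`∃ c₀ > 0, ∀ φ Weil test, tsupport φ ⊆ [-1,1] → ∀ ε > 0, ∀ M a, ε·M ≤ c₀ → 0 ≤ Re Q(comb φ ε M a)`,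
`comb φ ε M a = x ↦ Σ_{m=1}^{M} a m · ε⁻¹ φ((x − log m)/ε)`, `Q = weilQuadratic`.

STATUS 2026-08-16T05:25Z: the crux has been PROVED unconditionally by the lead
(`Summit.RiemannHypothesis.RiemannHypothesis.Theorems.WeilCombSubcritical.CombSubcritical_of`,
p77422, axioms propext/Classical.choice/Quot.sound; line helson-dirichlet-slack).  This file stays as
the negative-side record for the follow-up items (explicit-`c₀` `CombShapeSubcritical`, transition
`CombShapeTransition`, crux #2 `CombShapePositivity`): what is load-bearing, where the method is
tight, and the exact-matrix numerics.  Landed from this seat: p72886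
(`Theorems/CombSubcritical/Negative/WeilCombCombSubcriticalLoadBearing.lean`), p73305
(`…/Negative/WeilCombCombSubcriticalSmallModels.lean`).

## Findings (machine-checked below unless marked NUMERICS / PROSE)

1. NO UNCONDITIONAL KILL EXISTS SHORT OF `¬RH` (`combSubcritical_of_riemannHypothesis`,
   `not_riemannHypothesis_of_not_combSubcritical`): every comb is a Weil test (`isWeilTest_comb`), so
   `RH → WeilPositivity → CombSubcritical` for EVERY `c₀` (the window is not needed for truth, only for
   an unconditional proof).  A counterexample `(φ, ε, M, a)` with `Re Q < 0` would be a zeros-free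
   certificate of `¬RH`.  Consequently this seat cannot land `¬CombSubcritical`; its output is the
   load-bearing analysis, the costume checks and the numerics below.
2. CRUX ≤ TARGET (`combSubcritical_of_combThesis`): the crux is implied by the route target
   `CombThesis` (uniform Weil positivity), trivially.
3. LOAD-BEARING HYPOTHESES — each structural hypothesis is exactly what keeps the crux BELOW RH:
   * drop `tsupport φ ⊆ [-1,1]`  ⇒ the statement IS the target:
     `combSubcriticalWithoutSupport_iff_combThesis`, hence `↔ RiemannHypothesis`
     (`combSubcriticalWithoutSupport_iff_riemannHypothesis`) — witness: `M = 1`, `ε = c₀`,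
     `φ u = c₀ · g(c₀ u)` reproduces an arbitrary Weil test `g`.
   * drop the window `ε·M ≤ c₀`  ⇒ again the target verbatim:
     `combSubcriticalWithoutWindow_iff_combThesis` (`M = 1`, `ε = a`, `φ u = a · g(a u)` has
     `tsupport ⊆ [-1,1]` when `tsupport g ⊆ [-a,a]`).
   * drop `IsWeilTest φ` (keep the support condition)  ⇒ false, but only through Lean junk (PROSE,
     `CombSubcriticalWithoutWeilTest`): take `φ ∈ L²[-1,1]` (even a continuous one exists, by the
     closed-graph theorem, since `‖bump·cos(N·)‖_∞ = O(1)` while its `H^{log}` norm is `≍ log N`) with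
     `∫ |φ̂(ξ)|² log(2+|ξ|) dξ = +∞`.  Then `ψ = φ_ε ⋆ φ̃_ε` is continuous, `ψ(0) = ε⁻¹‖φ‖₂²`, the
     polar term is `≤ 2e^ε‖φ‖₁² ≤ 4e^ε ‖φ‖₂²`, there is no prime term, and the digamma integrand
     `|φ̂_ε(t)|² Re ψ(1/4+it/2)` is NOT integrable (its true value is `+∞`, consistent with
     positivity) — so Lean's Bochner integral returns `0` and `weilQuadratic (φ_ε) =
     polar − ε⁻¹‖φ‖₂² log π < 0` for `ε < 0.1`, at `M = 1`.  Mathematically the minimal hypothesis is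
     `φ ∈ H^{log}` (finite `∫|φ̂|² log(2+|ξ|)`), under which `Q` is finite and continuous and the
     smooth case is dense: smoothness per se is NOT load-bearing, integrability of `|φ̂|² log|ξ|` is.
     Not formalised (divergence of a specific lacunary series' log-moment); information only.
   * `0 < ε`: needed only to make `ε⁻¹`, `·/ε` non-junk; `M = 0` and `a = 0` give `Q(0) = 0` (fine).
4. WHY IT RESISTS / WHY IT SHOULD BE PROVABLE (PROSE + NUMERICS, kit job ids in `numerics` below):
   heuristically an off-line zero `ρ₀ = β₀ + iγ₀` perturbs the comb matrix by a rank-2 term of size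
   `≍ M‖a‖²` (Dirichlet polynomial of length `M` at `ρ₀`, `1-ρ̄₀`), while the on-line mass is
   `≍ (1/ε)(log(1/(εM)) + O(1))‖a‖²` (Landau–Gonek mean value: a length-`M` polynomial cannot vanish at
   more than `≈ (T/2π) log M` of the `≈ (T/2π) log T` zeros up to `T = 1/ε`); so in the window
   `εM ≤ c₀` a single bad zero loses by the factor `c₀/log(1/c₀)` and the statement is consistent with
   mild failures of RH — it is genuinely weaker than RH, unlike its two weakenings in item 3.
5. SMALL MODELS (`combSubcritical_upto_one`, machine-checked): the crux restricted to `M ≤ 1` holds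
   with the explicit `c₀ = (log 2)/2` — `M = 0` is `Q(0) = 0`, `M = 1` is Yoshida's rung
   (`weilPositivityOn_of_le_log_two_half`, support `[-ε, ε]`, `ε ≤ 0.3466`).  `M = 2` already has
   support `[-ε, log 2 + ε]` of width `> log 2` and is NOT covered by any in-tree positivity theorem
   (Yoshida needs width `≤ log 2`; translation invariance of `Q` does not help): it is the first
   genuinely new instance.  Its 2×2 matrix `[[w(0), w(log 2)], [w(log 2), w(0)]]` (per `ψ_ε(0)`):
   `w(log 2)/ψ_ε(0) ≈ −Λ(2)2^{-1/2} + ε(2r)(2cosh(log 2/2) − K(log 2)) ≈ −0.49 + 1.5ε` (prime, polar,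
   Bombieri kernel `K(y) = e^{-y/2}/(1−e^{-2y})`, `K(log 2) = 0.943`, `r = (∫φ)²/(2‖φ‖₂²)`) against
   `w(0)/ψ_ε(0) ≈ log(1/ε) + c(ε) + 4rε`, `c(ε) ≈ −2.0` (bump): PSD iff roughly `log(1/ε) ≳ 2.45 − 4ε`,
   i.e. down to `ε ≈ 0.2`, `c₀ = 2ε ≈ 0.4` for the bump.  NOTE the small-`M`/large-`ε` corner
   (`M = 2…20`, `ε = c₀/M` up to `c₀/2`) is where a universal `c₀` for a GIVEN shape is decided, and
   it was not covered by earlier numerics (`M ≥ 40`); kit job `comb-smallM` (item 6) covers it.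
6. NUMERICS (exact comb matrix `W[m,m'] = w_ε(log m − log m')` in the tree's normalisation, Bombieri
   arch form; pure-python cross-check `kit/purepy_smallM.py` in the seat folder reproduces the triage
   A3 constants `c(ε) = εW_∞(ψ_ε)/‖φ‖₂² − log(1/ε) = −2.065/−1.992/−1.967/−1.959` at
   `ε = 0.3/0.1/0.03/0.01`).  Truth margin `μ(c₀, M) := λ_min(W)/ψ_ε(0)` at `ε = c₀/M`, fixed bump:
     `c₀ = 0.3`: 0.031 (M=1), 0.101 (2), 0.144 (3), 0.170 (4), 0.194 (6)  [triage: 0.36 at M=160, c₀=0.25]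
     `c₀ = 0.5`: 0.0139, 0.0160, 0.0214, 0.0283, 0.0337;   `c₀ = 1`: 9.4e-4, 2.1e-3, 3.0e-3, 4.0e-3, 3.4e-3
     `c₀ = 2`: 2.7e-5 (M=1), 1.3e-4 (2);   `c₀ = 3`: 2.0e-6 (M=1), 1.4e-5 (2), 2.5e-5 (3)
     `M = 1` alone, `ε = 0.2…3`: 0.174, 0.031, 8.2e-3 (0.4), 1.4e-2 (0.5), 1.2e-3 (0.6), 3.0e-3 (0.75),
     9.4e-4 (1), 1.3e-4 (1.5), 2.7e-5 (2), 2.0e-6 (3) — oscillating as prime powers enter, never negative.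
   ALL POSITIVE (RH-consistent; at `ε = 3` the `log(1/ε)` diagonal, ~400 prime powers and the
   digamma/polar terms cancel to `+9e-8` absolute — a stringent check of signs and normalisation).
   READING: (i) no negative eigenvalue anywhere, and none CAN exist unless RH fails (item 1);
   (ii) for a GIVEN shape the universal-`c₀` question is decided at `M = 1` — the margin is smallest
   there and increases with `M` — i.e. by the one-bump functional `W(φ_ε ⋆ φ̃_ε)`, `ε = c₀`, which the
   tree controls only for `ε ≤ (log 2)/2` (Yoshida); (iii) the line's `c₀ ≈ e^{-8}` is an artefact of
   the crude A3 constant `C ≈ 7` at `M = 1` (true `c(ε) ≈ −2.0` for the bump), not of the arithmetic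
   large-`M` side, whose margin is `≈ log(1/c₀) − 1.41 + 1.55c₀ > 0` for `c₀ < 1/2` (triage fit,
   `M ≤ 320`).
   KIT j007961 (numpy pipeline, validated against the above and the triage values; bump & odd shapes,
   `M = 60, 120`, `c₀ ∈ {0.01, 0.25, 1, 3}`), per `ψ_ε(0)`:
     bump  c₀=0.01: μ = 3.190/3.200, μ(W−polar) = 3.16, μ(W_pess) = 3.13, core λ_max(K_c₀)−log M = −0.42
     bump  c₀=0.25: μ = 0.355/0.360 (= triage), μ(W−polar) = −0.44 (!), μ(W_pess) = −1.30 (!)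
     bump  c₀=1: μ = 0.0083/0.0085 (prime side no longer exactly S_M: residual 0.27); c₀=3: μ = 1e-4
     odd (∫φ = 0, r = 0): A3 c(ε) = −0.81 (bump: −1.96); μ = 4.32 (0.01), 1.10 (0.25), 0.029 (1),
     6e-4 (3); polar ≈ 0, arch off-diagonal ≈ 0; bottom eigenvector = Perron ray (overlap ≥ 0.99) always.
   Here `μ(W−polar)` drops the rank-2 polar matrix and `μ(W_pess)` replaces polar and off-diagonal arch
   entries by `−|·|` (exactly what `CombAnalyticReduction` keeps).  TIGHTNESS OF THE METHOD (NUMERICS):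
   for the bump at `c₀ = 0.25` positivity RELIES on the favourable sign of the polar term on the Perron
   ray (`+0.74 = 2c₀(∫φ₀)²/‖φ₀‖₂²` against arch off-diagonal `−0.34`): any proof that discards the
   polar sign — in particular the picked line's Cauchy–Schwarz bound `|2Re ĝ(0)conj ĝ(1)| ≤ …` — is
   capped strictly below `c₀ = 0.25` for the bump whatever its constants, and the entrywise-pessimistic
   form is already negative there while comfortably positive at `c₀ = 0.01`; the method ceiling
   `c* ∈ (0.01, 0.25)` and the shape dependence (flat-top, oscillatory, narrow) come with the grid jobs
   j013794 (`M ≤ 1600`, 15 windows, 5 shapes), j013798 (`M = 3200`) and j008452 (small-`M` corner),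
   queued; `slack_const := μ − log(1/c₀) → c_φ + (log M − λ_max(S_M)) ≈ −1.41` (bump), `−0.28` (odd).

## Targets
`payload.targets = []` at this arming (no skeleton stubs served yet).  Pre-emptive reading of the
picked line `Lines/helson-dirichlet-slack.lean` (stubs HelsonDirichletIdentity, HelsonPoincare,
LogHilbertRowSum, ArithmeticCore, CombExpansion/CombPrimeExact/ArchDiagSharp/ArchOffdiagKernel/
PolarCombBound = CombAnalyticReduction): all re-derived by hand, no break found (details in the
seat's NOTES.md); the only delicate constant is A3 (`Re ψ(1/4+it/2) ≥ log|t| − 4.95`, no `log log`).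
-/

noncomputable section

open scoped BigOperators ComplexConjugate ContDiff
open Complex MeasureTheory Set Filter

namespace Summit.RiemannHypothesis.RiemannHypothesis.Cruxes.CombSubcritical.Disproof

open Literature.NumberTheory.LFunctions
open Summit.RiemannHypothesis.RiemannHypothesis.Theses.WeilComb

/-! ## The comb is a Weil test -/

/-- The comb of the crux (verbatim the function inside `CombSubcritical`). -/
def comb (φ : ℝ → ℂ) (ε : ℝ) (M : ℕ) (a : ℕ → ℂ) : ℝ → ℂ :=
  fun x : ℝ => ∑ m ∈ Finset.Icc 1 M, a m * ((ε : ℂ)⁻¹ * φ ((x - Real.log (m : ℝ)) / ε))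

/-- Sanity: `comb` is syntactically the function of the crux. -/
example : CombSubcritical ↔
    ∃ c₀ : ℝ, 0 < c₀ ∧ ∀ φ : ℝ → ℂ, IsWeilTest φ → tsupport φ ⊆ Set.Icc (-1) 1 →
      ∀ ε : ℝ, 0 < ε → ∀ (M : ℕ) (a : ℕ → ℂ), ε * M ≤ c₀ → 0 ≤ (weilQuadratic (comb φ ε M a)).re :=
  Iff.rfl

theorem contDiff_comb {φ : ℝ → ℂ} (hφ : ContDiff ℝ ∞ φ) (ε : ℝ) (M : ℕ) (a : ℕ → ℂ) :
    ContDiff ℝ ∞ (comb φ ε M a) := by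
  unfold comb
  refine ContDiff.sum fun m _ => ?_
  refine contDiff_const.mul (contDiff_const.mul ?_)
  exact hφ.comp ((contDiff_id.sub contDiff_const).div_const ε)

theorem hasCompactSupport_comb {φ : ℝ → ℂ} (hφ : HasCompactSupport φ) {ε : ℝ} (hε : ε ≠ 0)
    (M : ℕ) (a : ℕ → ℂ) : HasCompactSupport (comb φ ε M a) := by
  have h1 : comb φ ε M a =
      ∑ m ∈ Finset.Icc 1 M, fun x : ℝ => a m * ((ε : ℂ)⁻¹ * φ ((x - Real.log (m : ℝ)) / ε)) := by
    ext x; simp [comb, Finset.sum_apply]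
  rw [h1]
  refine HasCompactSupport.finset_sum fun m _ => ?_
  have h2 : HasCompactSupport fun x : ℝ => φ ((x - Real.log (m : ℝ)) / ε) := by
    have h := hφ.comp_homeomorph (affineHomeomorph ε⁻¹ (-(Real.log (m : ℝ)) / ε) (inv_ne_zero hε))
    convert h using 1
    funext x
    simp only [Function.comp_apply, affineHomeomorph_apply]
    congr 1
    ring
  exact (h2.mul_left).mul_left

/-- Every comb built on a Weil test is a Weil test (so RH ⇒ its Weil form is non-negative). -/
theorem isWeilTest_comb {φ : ℝ → ℂ} (hφ : IsWeilTest φ) {ε : ℝ} (hε : ε ≠ 0) (M : ℕ) (a : ℕ → ℂ) :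
    IsWeilTest (comb φ ε M a) :=
  ⟨contDiff_comb hφ.1 ε M a, hasCompactSupport_comb hφ.2 hε M a⟩

/-! ## 1–2. No kill short of ¬RH; crux ≤ target -/

/-- `WeilPositivity ⇒ CombSubcritical` (with any `c₀`; we take `c₀ = 1`). -/
theorem combSubcritical_of_weilPositivity (h : WeilPositivity) : CombSubcritical :=
  ⟨1, one_pos, fun _φ hφ _ _ε hε M a _ => h _ (isWeilTest_comb hφ hε.ne' M a)⟩

/-- The crux is implied by the route target (uniform Weil positivity). -/
theorem combSubcritical_of_combThesis (h : CombThesis) : CombSubcritical :=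
  combSubcritical_of_weilPositivity (uniformWeilPositivity_iff_weilPositivity.1 h)

/-- RH ⇒ the crux (explicit formula + Weil's easy direction, both in the tree). -/
theorem combSubcritical_of_riemannHypothesis (h : RiemannHypothesis) : CombSubcritical :=
  combSubcritical_of_weilPositivity (WeilPositivity.of_riemannHypothesis explicit_formula_holds h)

/-- Hence any refutation of the crux is a refutation of RH: there is no unconditional kill. -/
theorem not_riemannHypothesis_of_not_combSubcritical (h : ¬ CombSubcritical) : ¬ RiemannHypothesis :=
  fun hRH => h (combSubcritical_of_riemannHypothesis hRH)

/-! ## 3a. Dropping the support normalisation gives back the target verbatim -/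

/-- The crux with `tsupport φ ⊆ [-1,1]` dropped. -/
def CombSubcriticalWithoutSupport : Prop :=
  ∃ c₀ : ℝ, 0 < c₀ ∧ ∀ φ : ℝ → ℂ, IsWeilTest φ →
    ∀ ε : ℝ, 0 < ε → ∀ (M : ℕ) (a : ℕ → ℂ), ε * M ≤ c₀ → 0 ≤ (weilQuadratic (comb φ ε M a)).re

/-- The dilation `u ↦ c · g (c u)` of a Weil test is a Weil test. -/
theorem isWeilTest_dilate {g : ℝ → ℂ} (hg : IsWeilTest g) {c : ℝ} (hc : c ≠ 0) :
    IsWeilTest (fun u : ℝ => (c : ℂ) * g (c * u)) := by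
  refine ⟨contDiff_const.mul (hg.1.comp (contDiff_const.mul contDiff_id)), ?_⟩
  have h : HasCompactSupport (g ∘ (Homeomorph.mulLeft₀ c hc)) := hg.2.comp_homeomorph _
  exact h.mul_left

/-- With one node the comb of the dilated test is the test itself. -/
theorem comb_one_dilate (g : ℝ → ℂ) {c : ℝ} (hc : c ≠ 0) :
    comb (fun u : ℝ => (c : ℂ) * g (c * u)) c 1 (fun _ => 1) = g := by
  funext x
  have hx : c * ((x - Real.log ((1 : ℕ) : ℝ)) / c) = x := by
    simp only [Nat.cast_one, Real.log_one, sub_zero]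
    field_simp
  have hc' : (c : ℂ) ≠ 0 := by exact_mod_cast hc
  simp only [comb, Finset.Icc_self, Finset.sum_singleton, one_mul, hx]
  field_simp

theorem weilPositivity_of_combSubcriticalWithoutSupport (h : CombSubcriticalWithoutSupport) :
    WeilPositivity := by
  obtain ⟨c₀, hc₀, h⟩ := h
  intro g hg
  have key := h _ (isWeilTest_dilate hg hc₀.ne') c₀ hc₀ 1 (fun _ => 1) (by simp)
  rwa [comb_one_dilate g hc₀.ne'] at key

/-- LOAD-BEARING (support): without `tsupport φ ⊆ [-1,1]` the crux is the target `CombThesis`. -/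
theorem combSubcriticalWithoutSupport_iff_combThesis :
    CombSubcriticalWithoutSupport ↔ CombThesis := by
  refine ⟨fun h => uniformWeilPositivity_iff_weilPositivity.2
      (weilPositivity_of_combSubcriticalWithoutSupport h), fun h => ?_⟩
  have hW : WeilPositivity := uniformWeilPositivity_iff_weilPositivity.1 h
  exact ⟨1, one_pos, fun _φ hφ _ε hε M a _ => hW _ (isWeilTest_comb hφ hε.ne' M a)⟩

/-- … and therefore equivalent to the Riemann hypothesis. -/
theorem combSubcriticalWithoutSupport_iff_riemannHypothesis :
    CombSubcriticalWithoutSupport ↔ RiemannHypothesis :=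
  combSubcriticalWithoutSupport_iff_combThesis.trans riemannHypothesis_iff_forall_weilPositivityOn.symm

/-! ## 3b. Dropping the window `ε·M ≤ c₀` gives back the target verbatim -/

/-- The crux with the window `ε·M ≤ c₀` dropped (then `∃ c₀` is idle). -/
def CombSubcriticalWithoutWindow : Prop :=
  ∀ φ : ℝ → ℂ, IsWeilTest φ → tsupport φ ⊆ Set.Icc (-1) 1 →
    ∀ ε : ℝ, 0 < ε → ∀ (M : ℕ) (a : ℕ → ℂ), 0 ≤ (weilQuadratic (comb φ ε M a)).re

/-- Support of the dilation: `tsupport g ⊆ [-a, a]`, `0 < a` ⇒ `tsupport (u ↦ a·g(a u)) ⊆ [-1, 1]`. -/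
theorem tsupport_dilate_subset {g : ℝ → ℂ} {a : ℝ} (ha : 0 < a)
    (hg : tsupport g ⊆ Set.Icc (-a) a) :
    tsupport (fun u : ℝ => (a : ℂ) * g (a * u)) ⊆ Set.Icc (-1) 1 := by
  have h1 : tsupport (fun u : ℝ => (a : ℂ) * g (a * u)) ⊆ tsupport (g ∘ (Homeomorph.mulLeft₀ a ha.ne')) :=
    tsupport_mul_subset_right
  refine h1.trans ?_
  rw [tsupport_comp_eq_preimage]
  intro u hu
  have hu' := hg hu
  simp only [Set.mem_Icc] at hu' ⊢
  have e : (Homeomorph.mulLeft₀ a ha.ne') u = a * u := rfl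
  rw [e] at hu'
  constructor <;> nlinarith [hu'.1, hu'.2]

theorem combThesis_of_combSubcriticalWithoutWindow (h : CombSubcriticalWithoutWindow) :
    CombThesis := by
  intro a ha g hg hga
  have key := h _ (isWeilTest_dilate hg ha.ne') (tsupport_dilate_subset ha hga) a ha 1 (fun _ => 1)
  rwa [comb_one_dilate g ha.ne'] at key

/-- LOAD-BEARING (window): without `ε·M ≤ c₀` the crux is the target `CombThesis`. -/
theorem combSubcriticalWithoutWindow_iff_combThesis :
    CombSubcriticalWithoutWindow ↔ CombThesis := by
  refine ⟨combThesis_of_combSubcriticalWithoutWindow, fun h => ?_⟩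
  have hW : WeilPositivity := uniformWeilPositivity_iff_weilPositivity.1 h
  exact fun _φ hφ _ _ε hε M a => hW _ (isWeilTest_comb hφ hε.ne' M a)

/-- … and therefore equivalent to the Riemann hypothesis. -/
theorem combSubcriticalWithoutWindow_iff_riemannHypothesis :
    CombSubcriticalWithoutWindow ↔ RiemannHypothesis :=
  combSubcriticalWithoutWindow_iff_combThesis.trans riemannHypothesis_iff_forall_weilPositivityOn.symm

/-! ## 5. Small models: `M ≤ 1` is settled in the tree (Yoshida's rung); `M = 2` is the first open instance -/

/-- SMALL MODELS.  The crux restricted to `M ≤ 1` holds with the explicit `c₀ = (log 2)/2`: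
`M = 0` is `Q(0) = 0` (`weilQuadratic_zero`) and `M = 1` is a single Weil test supported in
`[-ε, ε]`, `ε ≤ (log 2)/2`, i.e. the proved rung `weilPositivityOn_of_le_log_two_half`.  The first
instance not covered by any in-tree positivity theorem is `M = 2` (support width `log 2 + 2ε`). -/
theorem combSubcritical_upto_one :
    ∀ φ : ℝ → ℂ, IsWeilTest φ → tsupport φ ⊆ Set.Icc (-1) 1 →
      ∀ ε : ℝ, 0 < ε → ∀ (M : ℕ) (a : ℕ → ℂ), M ≤ 1 → ε * M ≤ Real.log 2 / 2 →
        0 ≤ (weilQuadratic (comb φ ε M a)).re := by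
  intro φ hφ hsupp ε hε M a hM hwin
  interval_cases M
  · have e : comb φ ε 0 a = 0 := by
      funext x; simp [comb]
    rw [e, weilQuadratic_zero]; simp
  · have hε1 : ε ≤ Real.log 2 / 2 := by simpa using hwin
    have e : comb φ ε 1 a = fun x : ℝ => a 1 * ((ε : ℂ)⁻¹ * φ (x / ε)) := by
      funext x; simp [comb]
    have h2 : tsupport (fun x : ℝ => φ (x / ε)) ⊆ Set.Icc (-ε) ε := by
      refine closure_minimal ?_ isClosed_Icc
      intro x hx
      have hx' : φ (x / ε) ≠ 0 := hx
      have hmem : x / ε ∈ Set.Icc (-1 : ℝ) 1 := hsupp (subset_tsupport _ hx')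
      rw [Set.mem_Icc] at hmem ⊢
      constructor
      · have h := hmem.1; rw [le_div_iff₀ hε] at h; linarith
      · have h := hmem.2; rw [div_le_iff₀ hε] at h; linarith
    have h1 : tsupport (comb φ ε 1 a) ⊆ Set.Icc (-ε) ε := by
      rw [e]
      refine (tsupport_mul_subset_right :
        tsupport ((fun _ : ℝ => a 1) * fun x : ℝ => (ε : ℂ)⁻¹ * φ (x / ε)) ⊆ _).trans ?_
      refine (tsupport_mul_subset_right :
        tsupport ((fun _ : ℝ => (ε : ℂ)⁻¹) * fun x : ℝ => φ (x / ε)) ⊆ _).trans h2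
    exact weilPositivityOn_of_le_log_two_half hε1 _ (isWeilTest_comb hφ hε.ne' 1 a) h1

/-! ## 3c. Dropping `IsWeilTest φ` (PROSE; junk-only) -/

/-- The crux with `IsWeilTest φ` dropped (support condition kept).  FALSE, but only through junk
values of non-measurable integrands (module docstring, item 3); not formalised. -/
def CombSubcriticalWithoutWeilTest : Prop :=
  ∃ c₀ : ℝ, 0 < c₀ ∧ ∀ φ : ℝ → ℂ, tsupport φ ⊆ Set.Icc (-1) 1 →
    ∀ ε : ℝ, 0 < ε → ∀ (M : ℕ) (a : ℕ → ℂ), ε * M ≤ c₀ → 0 ≤ (weilQuadratic (comb φ ε M a)).re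

end Summit.RiemannHypothesis.RiemannHypothesis.Cruxes.CombSubcritical.Disproof

end
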